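import Summits.Parity.GeneralizedHardyLittlewood.Theorems.PrimeLevelFamEdgeMomentsBeyondDiagonalDiagDecorPrimeSqCube
import Summits.Parity.GeneralizedHardyLittlewood.Theorems.PrimeLevelFamEdgeMomentsBeyondDiagonalDiagDecorPrimeSqPrimeFourth
import HarnessLib

/-!
# Route `PrimeLevelFamEdge`, crux K_A `MomentsBeyondDiagonal` (stmt-Parity-20007), line «petersson_layers» v4, stub `stub_diag`:
# **THE `M₆`-DECORATED COPRIME SELBERG SUM HAS NO MAIN TERM AT ORDER `log^{c+4}y`:
# `|Σ_{k≤y,(k,n)=1}τ(k)W(k)·(15P₂³ − 30P₂P₄ + 16P₆)(k)·logᶜ(y/k)| ≤ C·D(n)(1+κ(n))(1+log y)^{c+3}`** (`c ≥ 2`)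

The arithmetic core of the `M₆`-engine for the orders `i + j = 6` of `stub_diag` (`M₆ = τ(15P₂³ − 30P₂P₄ + 16P₆)` on squarefree
numbers, `…DiagDecorWeightRungThree.centralMoment_six_of_squarefree`), exactly as `…DiagDecorM4Coprime` for `M₄`: the three
families are `P₂³ ↦ −176`, `P₂P₄ ↦ −216`, `P₆ ↦ −240` in units `c!/(c+4)!·E_n log^{c+4}y` (`…DiagDecorPrimeSqCube`,
`…DiagDecorPrimeSqPrimeFourth`, `…DiagDecorPrimePowTwo … 5`) and `15(−176) − 30(−216) + 16(−240) = 0`.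

* `m6_cancellation` — the coefficient identity;
* `abs_coprimeSumPow_M6_le` — **the displayed bound**.

From here the `M₆` analogues of `…DiagDecorM4Coord/Collapse/Block/Family` (same proofs, decoration
`15(Σlog²p)³ − 30(Σlog²p)(Σlog⁴p) + 16Σlog⁶p`, crude sizes one logarithm higher per extra `log²`: coordinate `O(D(1+κ)log^{r+3}M)`)
give the `M₆`-family Selberg-form bounds `O(log^{m+2}M)` needed at orders `(1,3)`, `(3,3)`, `(2,4)`, `(0,4)`, `(4,4)`. Def-free;
theorems only. Helper `--supports stmt-Parity-20007`; closes nothing; K_A, K_B and the Parity summit are NOT proved; nothing about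
Landau–Siegel zeros.

## References
* E. Kowalski, P. Michel, J. VanderKam, J. reine angew. Math. 526 (2000), (23)–(28) pp. 13–15 and Prop. 5.1 p. 18.
  [cite: KowalskiMichelVanderKam2000, (23)–(28) — derivation (sixth central divisor-log moment of the Selberg coordinates)]
-/

noncomputable section

open scoped Real
open Finset ArithmeticFunction

namespace Summit.Parity.GeneralizedHardyLittlewood.Theorems.MomentsBeyondDiagonal.DiagKernel

open Literature.NumberTheory.LFunctions Literature.NumberTheory.LFunctions.KMV2000
open SelbergCoord (kappa)
open Summit.Parity.GeneralizedHardyLittlewood.Theorems.BeyondDiagonalBeatsQuarter.KernelFormXSq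
  (copTauW mainConst divWeight divWeight_nonneg mainConst_nonneg)

/-- The cancellation of the `log^{c+4}` main terms in `15P₂³ − 30P₂P₄ + 16P₆`: for `c ≥ 2`,
`15·176·(c!/(c+4)!) − 30·216·(c!/(c+4)!) + 16·(2c(c−1)·5!(c−2)!/(c+4)!) = 0`. [folklore] -/
theorem m6_cancellation {c : ℕ} (hc : 2 ≤ c) :
    15 * (176 * ((c.factorial : ℝ) / (c + 4).factorial)) - 30 * (216 * ((c.factorial : ℝ) / (c + 4).factorial)) +
        16 * (2 * ((c : ℝ) * ((c : ℝ) - 1)) * (((Nat.factorial 5 : ℕ) : ℝ) * (c - 2).factorial / (c + 4).factorial)) = 0 := by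
  obtain ⟨j, rfl⟩ : ∃ j, c = j + 2 := ⟨c - 2, by omega⟩
  have e1 : j + 2 - 2 = j := by omega
  rw [e1]
  have h2 : ((j + 2).factorial : ℝ) = ((j : ℝ) + 2) * ((j : ℝ) + 1) * j.factorial := by
    have : (j + 2).factorial = (j + 2) * ((j + 1) * j.factorial) := by
      rw [show j + 2 = (j + 1) + 1 by omega, Nat.factorial_succ, Nat.factorial_succ]
    rw [this]; push_cast; ring
  have hF4 : ((j + 2 + 4).factorial : ℝ) ≠ 0 := by exact_mod_cast Nat.factorial_ne_zero _
  rw [h2, show Nat.factorial 5 = 120 from rfl]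
  push_cast
  field_simp
  ring

/-- **The `M₆`-decorated coprime Selberg sum is `O(D(n)(1+κ(n))(1+log y)^{c+3})`** (`c ≥ 2`): there is `C` with, for all
`n ≥ 1`, `y ≥ 1`, `|Σ_{k≤y} a_n(k)·logᶜ(y/k)·(15P₂(k)³ − 30P₂(k)P₄(k) + 16P₆(k))| ≤ C·D(n)(1+κ(n))(1+log y)^{c+3}`.
[cite: KowalskiMichelVanderKam2000, (23)–(28) — derivation] -/
theorem abs_coprimeSumPow_M6_le {c : ℕ} (hc : 2 ≤ c) :
    ∃ C : ℝ, 0 < C ∧ ∀ n : ℕ, n ≠ 0 → ∀ y : ℝ, 1 ≤ y →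
      |∑ k ∈ Icc 1 ⌊y⌋₊, copTauW n k * Real.log (y / k) ^ c *
          (15 * (∑ p ∈ k.primeFactors, Real.log p ^ 2) ^ 3 -
            30 * ((∑ p ∈ k.primeFactors, Real.log p ^ 2) * ∑ p ∈ k.primeFactors, Real.log p ^ 4) +
            16 * ∑ p ∈ k.primeFactors, Real.log p ^ 6)| ≤
        C * divWeight n * (1 + kappa n) * (1 + Real.log y) ^ (c + 3) := by
  obtain ⟨C₃, hC₃, h₃⟩ := abs_coprimeSumPow_primeSqCube_add_le hc
  obtain ⟨C₂₄, hC₂₄, h₂₄⟩ := abs_coprimeSumPow_primeSq_primeFourth_add_le hc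
  obtain ⟨C₆, hC₆, h₆⟩ := abs_coprimeSumPow_primePow_add_le_of_two_le 5 hc
  refine ⟨15 * C₃ + 30 * C₂₄ + 16 * C₆, by positivity, fun n hn y hy ↦ ?_⟩
  set N := ⌊y⌋₊ with hN
  have hA := h₃ n hn y hy
  have hB := h₂₄ n hn y hy
  have hC := h₆ n hn y hy
  have e56 : c - 2 + 5 = c + 3 := by omega
  rw [show ((5 : ℕ) + 1) = 6 from rfl, e56] at hC
  have e6 : c + 3 + 1 = c + 4 := by omega
  rw [e6] at hC
  have hid := m6_cancellation hc
  -- linear decomposition of the `M₆` sum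
  have hlin : ∑ k ∈ Icc 1 N, copTauW n k * Real.log (y / k) ^ c *
        (15 * (∑ p ∈ k.primeFactors, Real.log p ^ 2) ^ 3 -
          30 * ((∑ p ∈ k.primeFactors, Real.log p ^ 2) * ∑ p ∈ k.primeFactors, Real.log p ^ 4) +
          16 * ∑ p ∈ k.primeFactors, Real.log p ^ 6) =
      15 * (∑ k ∈ Icc 1 N, copTauW n k * Real.log (y / k) ^ c * (∑ p ∈ k.primeFactors, Real.log p ^ 2) ^ 3 +
          176 * ((c.factorial : ℝ) / (c + 4).factorial) * mainConst n * Real.log y ^ (c + 4)) -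
        30 * (∑ k ∈ Icc 1 N, copTauW n k * Real.log (y / k) ^ c *
            ((∑ p ∈ k.primeFactors, Real.log p ^ 2) * ∑ p ∈ k.primeFactors, Real.log p ^ 4) +
          216 * ((c.factorial : ℝ) / (c + 4).factorial) * mainConst n * Real.log y ^ (c + 4)) +
        16 * (∑ k ∈ Icc 1 N, copTauW n k * Real.log (y / k) ^ c * ∑ p ∈ k.primeFactors, Real.log p ^ 6 +
          2 * ((c : ℝ) * ((c : ℝ) - 1)) * (((Nat.factorial 5 : ℕ) : ℝ) * (c - 2).factorial / (c + 4).factorial) *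
            mainConst n * Real.log y ^ (c + 4)) := by
    have hsum : ∑ k ∈ Icc 1 N, copTauW n k * Real.log (y / k) ^ c *
        (15 * (∑ p ∈ k.primeFactors, Real.log p ^ 2) ^ 3 -
          30 * ((∑ p ∈ k.primeFactors, Real.log p ^ 2) * ∑ p ∈ k.primeFactors, Real.log p ^ 4) +
          16 * ∑ p ∈ k.primeFactors, Real.log p ^ 6) =
      15 * ∑ k ∈ Icc 1 N, copTauW n k * Real.log (y / k) ^ c * (∑ p ∈ k.primeFactors, Real.log p ^ 2) ^ 3 -
        30 * ∑ k ∈ Icc 1 N, copTauW n k * Real.log (y / k) ^ c *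
            ((∑ p ∈ k.primeFactors, Real.log p ^ 2) * ∑ p ∈ k.primeFactors, Real.log p ^ 4) +
        16 * ∑ k ∈ Icc 1 N, copTauW n k * Real.log (y / k) ^ c * ∑ p ∈ k.primeFactors, Real.log p ^ 6 := by
      rw [Finset.mul_sum, Finset.mul_sum, Finset.mul_sum, ← Finset.sum_sub_distrib, ← Finset.sum_add_distrib]
      exact Finset.sum_congr rfl fun k _ ↦ by ring
    rw [hsum]
    have hm : 15 * (176 * ((c.factorial : ℝ) / (c + 4).factorial) * mainConst n * Real.log y ^ (c + 4)) -
        30 * (216 * ((c.factorial : ℝ) / (c + 4).factorial) * mainConst n * Real.log y ^ (c + 4)) +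
        16 * (2 * ((c : ℝ) * ((c : ℝ) - 1)) * (((Nat.factorial 5 : ℕ) : ℝ) * (c - 2).factorial / (c + 4).factorial) *
          mainConst n * Real.log y ^ (c + 4)) = 0 := by
      rw [show 15 * (176 * ((c.factorial : ℝ) / (c + 4).factorial) * mainConst n * Real.log y ^ (c + 4)) -
        30 * (216 * ((c.factorial : ℝ) / (c + 4).factorial) * mainConst n * Real.log y ^ (c + 4)) +
        16 * (2 * ((c : ℝ) * ((c : ℝ) - 1)) * (((Nat.factorial 5 : ℕ) : ℝ) * (c - 2).factorial / (c + 4).factorial) *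
          mainConst n * Real.log y ^ (c + 4)) =
        (15 * (176 * ((c.factorial : ℝ) / (c + 4).factorial)) - 30 * (216 * ((c.factorial : ℝ) / (c + 4).factorial)) +
          16 * (2 * ((c : ℝ) * ((c : ℝ) - 1)) * (((Nat.factorial 5 : ℕ) : ℝ) * (c - 2).factorial / (c + 4).factorial))) *
          (mainConst n * Real.log y ^ (c + 4)) by ring, hid, zero_mul]
    linear_combination -hm
  rw [hlin]
  calc _ ≤ |15 * (∑ k ∈ Icc 1 N, copTauW n k * Real.log (y / k) ^ c * (∑ p ∈ k.primeFactors, Real.log p ^ 2) ^ 3 +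
          176 * ((c.factorial : ℝ) / (c + 4).factorial) * mainConst n * Real.log y ^ (c + 4))| +
        |30 * (∑ k ∈ Icc 1 N, copTauW n k * Real.log (y / k) ^ c *
            ((∑ p ∈ k.primeFactors, Real.log p ^ 2) * ∑ p ∈ k.primeFactors, Real.log p ^ 4) +
          216 * ((c.factorial : ℝ) / (c + 4).factorial) * mainConst n * Real.log y ^ (c + 4))| +
        |16 * (∑ k ∈ Icc 1 N, copTauW n k * Real.log (y / k) ^ c * ∑ p ∈ k.primeFactors, Real.log p ^ 6 +
          2 * ((c : ℝ) * ((c : ℝ) - 1)) * (((Nat.factorial 5 : ℕ) : ℝ) * (c - 2).factorial / (c + 4).factorial) *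
            mainConst n * Real.log y ^ (c + 4))| := by
        refine (abs_add_le _ _).trans (add_le_add (abs_sub _ _) le_rfl)
    _ ≤ 15 * (C₃ * divWeight n * (1 + kappa n) * (1 + Real.log y) ^ (c + 3)) +
        30 * (C₂₄ * divWeight n * (1 + kappa n) * (1 + Real.log y) ^ (c + 3)) +
        16 * (C₆ * divWeight n * (1 + kappa n) * (1 + Real.log y) ^ (c + 3)) := by
        rw [abs_mul, abs_mul, abs_mul, abs_of_pos (by norm_num : (0 : ℝ) < 15), abs_of_pos (by norm_num : (0 : ℝ) < 30),
          abs_of_pos (by norm_num : (0 : ℝ) < 16)]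
        exact add_le_add (add_le_add (mul_le_mul_of_nonneg_left hA (by norm_num))
          (mul_le_mul_of_nonneg_left hB (by norm_num))) (mul_le_mul_of_nonneg_left hC (by norm_num))
    _ = (15 * C₃ + 30 * C₂₄ + 16 * C₆) * divWeight n * (1 + kappa n) * (1 + Real.log y) ^ (c + 3) := by ring

end Summit.Parity.GeneralizedHardyLittlewood.Theorems.MomentsBeyondDiagonal.DiagKernel

end
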